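import Summits.ResolutionOfSingularities.ResolutionOfSingularities.Theorems.FrobeniusLadderFInjectiveMacaulayficationGxzOffOrigin
import HarnessLib

/-!
# RGDD-L row F008 at `p = 5` — data for the CONE CLAUSE `hoff₀` of `g₀ = z² + t⁴w⁶ + (y² + x³)³ + t·x³y·w³`: two slicings of
# `k[X₀,…,X₄]` and the three Fedder coefficients of `g₀⁴` along the cusp surface `S = V(z, w, y² + x³)` and the `w`-axis `W = V(x, y, z, t)`
# (crux `FInjectiveMacaulayfication` stmt-ResolutionOfSingularities-15315, relative filtered engine `FilteredConeFiModelRel`;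
# RULING R15.39 (2) + ERRATUM 18:55:29Z + R15.48 (4) of res-L1-w45a-plan-1)

Support file for crux stmt-ResolutionOfSingularities-15315 (`FrobeniusLadder.FInjectiveMacaulayfication`), chain w45a, seat
res-L1-w45a-stub-1 g6. [OURS · L1 W4.5a; specimen = RGDD-L row F008 (res-L1-w45a-idea-2); singular locus and the three Fedder
coefficients machine-confirmed (kit j287843: minimal primes of `Jac(g₀)` over `𝔽₅` are `(t,z,y,x)` and `(x³+y², w, z)`; coefficients
`w⁶`, `2x³yφ³`, `2t·x³yφ³` mod `5`); templates `GxzOffOrigin` (res-L1-w45a-stub-4) and `FedderViaSlicing(NotMem)` (stub-3 / stub-4)] —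
NOT a statement of the manuscript [claim: Hironaka2017]; AI-written, weaker than expert review.

`g₀ = X₂² + X₄⁴X₃⁶ + (X₁² + X₀³)³ + X₄X₀³X₁X₃³` (`x,y,z,w,t = X₀,…,X₄`, `φ = X₁² + X₀³`) is the `(2,3,9,3 | 0)`-initial form of the
diagonalised row F008 (`…RelGddF008Data`).  In characteristic `5` its singular locus is `S ∪ W`,
`S = V(z, w, φ)` (the cusp surface, containing the `t`-axis `L`) and `W = V(x, y, z, t)` (the `w`-axis): all five partials in a prime
`P ∋ g₀` force `P ⊇ (z, w, φ)` or `P ⊇ (x, y, z, t)`.  Off `L`: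

* off `S ∪ W`: some partial `∉ P` ⇒ regular ⇒ clause (`ClauseOfPderivNotMem`);
* along `S ∖ L` (`x, y ∉ P`, `φ ∈ P`): if `t ∈ P`, PLANE SLICING `k[X] ≃ k[x,y][Z,W,T]` (`GxzOffOrigin.exists_planeSlicing5`), the
  `z⁴w³t`-coefficient of `g₀⁴` is `12·x³y·φ³` (`coeff_along_S_plane`); if `t ∉ P`, the slicing `k[X] ≃ k[x,y,t][Z,W]`
  (`exists_xytSlicing5`), the `z⁴w³`-coefficient of `g₀⁴` is `12·t·x³y·φ³` (`coeff_along_S_xyt`); either way the point-unit variant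
  `FedderViaSlicingNotMem.clause_of_sliceCoeff_of_not_mem` with `m = 3 ≤ p − 1` and `∂φ/∂y = 2y ∉ 𝔭` (transversal type `z² + φ³ + u·w³`);
* along `W ∖ 0` (`x, y, z, t ∈ P`, `w ∉ P`): the `w`-AXIS SLICING `k[X] ≃ k[w][x,y,z,t]` (`exists_wAxisSlicing5`), the
  `x³y⁴z⁴t⁴`-coefficient of `g₀⁴` is `36·w⁶` (`coeff_along_W`), a unit at the point (`φ = 1`, `m = 0`; transversal type
  `z² + w⁶t⁴ + (y² + x³)³ + w³·tx³y`, Fedder survivor `z⁴t⁴x³y⁴`).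

The clause itself (`RelGddF008Cone.g0_offL_clause_char5`, the hypothesis `hoff₀` of `FilteredConeFiModelRel.filteredConeFiModelRel_affineBlowup`
for `n = 5`, `J = {0,1,2,3}`, `p = 5`) is assembled from these in the companion file `…RelGddF008Cone`.  All proofs are glue on Mathlib and landed files; no definitions, no named facts. References:
[Fedder1983] R. Fedder, *F-purity and rational singularity*, Trans. AMS 278 (1983), Thm. 1.12 (through the imported criteria). [folklore]
-/

-- single-problem summit: the doubled namespace component is forced
set_option linter.dupNamespace false

noncomputable section

namespace Summit.ResolutionOfSingularities.ResolutionOfSingularities.Theorems.FInjectiveMacaulayfication.RelGddF008ConeData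

open MvPolynomial IsLocalRing
open Summit.ResolutionOfSingularities.ResolutionOfSingularities.Theorems.FInjectiveMacaulayfication

/-! ## Two slicings of `k[X₀,…,X₄]` -/

/-- **`w`-axis slicing** `k[X₀,…,X₄] ≃ k[X₃][Y₀,…,Y₃]`: `X₀,X₁,X₂ ↦ Y₀,Y₁,Y₂`, `X₃ ↦ C X₀` (base `k[w]`), `X₄ ↦ Y₃`. [folklore] -/
theorem exists_wAxisSlicing5 (k : Type) [Field k] :
    ∃ Ψ : MvPolynomial (Fin 5) k ≃+* MvPolynomial (Fin 4) (MvPolynomial (Fin 1) k),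
      Ψ (X 0) = X 0 ∧ Ψ (X 1) = X 1 ∧ Ψ (X 2) = X 2 ∧ Ψ (X 3) = C (X 0) ∧ Ψ (X 4) = X 3 := by
  have e0 : ((Equiv.swap (3 : Fin 5) 4).trans (@finSumFinEquiv 4 1).symm) 0 = Sum.inl 0 := by decide
  have e1 : ((Equiv.swap (3 : Fin 5) 4).trans (@finSumFinEquiv 4 1).symm) 1 = Sum.inl 1 := by decide
  have e2 : ((Equiv.swap (3 : Fin 5) 4).trans (@finSumFinEquiv 4 1).symm) 2 = Sum.inl 2 := by decide
  have e3 : ((Equiv.swap (3 : Fin 5) 4).trans (@finSumFinEquiv 4 1).symm) 3 = Sum.inr 0 := by decide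
  have e4 : ((Equiv.swap (3 : Fin 5) 4).trans (@finSumFinEquiv 4 1).symm) 4 = Sum.inl 3 := by decide
  refine ⟨((renameEquiv k ((Equiv.swap (3 : Fin 5) 4).trans (@finSumFinEquiv 4 1).symm)).trans
    (sumAlgEquiv k (Fin 4) (Fin 1))).toRingEquiv, ?_, ?_, ?_, ?_, ?_⟩
  · show sumAlgEquiv k (Fin 4) (Fin 1) (rename _ (X 0)) = _
    rw [rename_X, e0]; exact sumAlgEquiv_X_inl _ _ _ _
  · show sumAlgEquiv k (Fin 4) (Fin 1) (rename _ (X 1)) = _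
    rw [rename_X, e1]; exact sumAlgEquiv_X_inl _ _ _ _
  · show sumAlgEquiv k (Fin 4) (Fin 1) (rename _ (X 2)) = _
    rw [rename_X, e2]; exact sumAlgEquiv_X_inl _ _ _ _
  · show sumAlgEquiv k (Fin 4) (Fin 1) (rename _ (X 3)) = _
    rw [rename_X, e3]; exact sumAlgEquiv_X_inr _ _ _ _
  · show sumAlgEquiv k (Fin 4) (Fin 1) (rename _ (X 4)) = _
    rw [rename_X, e4]; exact sumAlgEquiv_X_inl _ _ _ _

/-- **`(x,y,t)`-base slicing** `k[X₀,…,X₄] ≃ k[X₀,X₁,X₄][Y₀,Y₁]`: `X₀ ↦ C X₀`, `X₁ ↦ C X₁`, `X₄ ↦ C X₂` (base `k[x,y,t]`), `X₂ ↦ Y₀`,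
`X₃ ↦ Y₁` (slices `z, w`). [folklore] -/
theorem exists_xytSlicing5 (k : Type) [Field k] :
    ∃ Ψ : MvPolynomial (Fin 5) k ≃+* MvPolynomial (Fin 2) (MvPolynomial (Fin 3) k),
      Ψ (X 0) = C (X 0) ∧ Ψ (X 1) = C (X 1) ∧ Ψ (X 2) = X 0 ∧ Ψ (X 3) = X 1 ∧ Ψ (X 4) = C (X 2) := by
  have e0 : (((Equiv.swap (0 : Fin 5) 2).trans (Equiv.swap (1 : Fin 5) 3)).trans (@finSumFinEquiv 2 3).symm) 0 = Sum.inr 0 := by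
    decide
  have e1 : (((Equiv.swap (0 : Fin 5) 2).trans (Equiv.swap (1 : Fin 5) 3)).trans (@finSumFinEquiv 2 3).symm) 1 = Sum.inr 1 := by
    decide
  have e2 : (((Equiv.swap (0 : Fin 5) 2).trans (Equiv.swap (1 : Fin 5) 3)).trans (@finSumFinEquiv 2 3).symm) 2 = Sum.inl 0 := by
    decide
  have e3 : (((Equiv.swap (0 : Fin 5) 2).trans (Equiv.swap (1 : Fin 5) 3)).trans (@finSumFinEquiv 2 3).symm) 3 = Sum.inl 1 := by
    decide
  have e4 : (((Equiv.swap (0 : Fin 5) 2).trans (Equiv.swap (1 : Fin 5) 3)).trans (@finSumFinEquiv 2 3).symm) 4 = Sum.inr 2 := by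
    decide
  refine ⟨((renameEquiv k (((Equiv.swap (0 : Fin 5) 2).trans (Equiv.swap (1 : Fin 5) 3)).trans (@finSumFinEquiv 2 3).symm)).trans
    (sumAlgEquiv k (Fin 2) (Fin 3))).toRingEquiv, ?_, ?_, ?_, ?_, ?_⟩
  · show sumAlgEquiv k (Fin 2) (Fin 3) (rename _ (X 0)) = _
    rw [rename_X, e0]; exact sumAlgEquiv_X_inr _ _ _ _
  · show sumAlgEquiv k (Fin 2) (Fin 3) (rename _ (X 1)) = _
    rw [rename_X, e1]; exact sumAlgEquiv_X_inr _ _ _ _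
  · show sumAlgEquiv k (Fin 2) (Fin 3) (rename _ (X 2)) = _
    rw [rename_X, e2]; exact sumAlgEquiv_X_inl _ _ _ _
  · show sumAlgEquiv k (Fin 2) (Fin 3) (rename _ (X 3)) = _
    rw [rename_X, e3]; exact sumAlgEquiv_X_inl _ _ _ _
  · show sumAlgEquiv k (Fin 2) (Fin 3) (rename _ (X 4)) = _
    rw [rename_X, e4]; exact sumAlgEquiv_X_inr _ _ _ _

/-! ## The three extracted coefficients of `g₀⁴` -/

/-- **Along `W`: the `x³y⁴z⁴t⁴`-coefficient of `g₀⁴` is `36·w⁶`.**  In `k[w][Y₀,…,Y₃]` (`Y₃ = t`) with `G = Y₂² + u`,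
`u = C(w)⁶Y₃⁴ + (Y₁² + Y₀³)³ + C(w)³Y₃Y₀³Y₁`: binomial in `Y₂` (`C(4,2) = 6`), then the explicit square `u²`, whose only monomial
`Y₃⁴Y₀³Y₁⁴` comes from `2·C(w⁶)Y₃⁴·3Y₁⁴Y₀³`. [folklore] -/
theorem coeff_along_W (k : Type) [Field k] (a : MvPolynomial (Fin 1) k) :
    coeff (Finsupp.single (2 : Fin 4) (2 * 2) + (Finsupp.single 3 4 + Finsupp.single 0 3 + Finsupp.single 1 4))
      ((X 2 ^ 2 + (C a ^ 6 * X 3 ^ 4 + (X 1 ^ 2 + X 0 ^ 3) ^ 3 + C a ^ 3 * X 3 * X 0 ^ 3 * X 1) :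
        MvPolynomial (Fin 4) (MvPolynomial (Fin 1) k)) ^ 4) = 36 * a ^ 6 := by
  set u : MvPolynomial (Fin 4) (MvPolynomial (Fin 1) k) := C a ^ 6 * X 3 ^ 4 + (X 1 ^ 2 + X 0 ^ 3) ^ 3 + C a ^ 3 * X 3 * X 0 ^ 3 * X 1
    with hu_def
  have hφdeg : degreeOf 2 (X 1 ^ 2 + X 0 ^ 3 : MvPolynomial (Fin 4) (MvPolynomial (Fin 1) k)) = 0 := by
    apply Nat.eq_zero_of_le_zero
    refine (degreeOf_add_le _ _ _).trans (max_le ?_ ?_) <;>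
    · refine (degreeOf_pow_le _ _ _).trans ?_
      rw [degreeOf_X, if_neg (by decide), mul_zero]
  have hCdeg : ∀ n : ℕ, degreeOf 2 (C a ^ n : MvPolynomial (Fin 4) (MvPolynomial (Fin 1) k)) = 0 := fun n => by
    apply Nat.eq_zero_of_le_zero
    refine (degreeOf_pow_le _ _ _).trans ?_
    rw [degreeOf_C, mul_zero]
  have hu : degreeOf 2 u = 0 := by
    apply Nat.eq_zero_of_le_zero
    refine (degreeOf_add_le _ _ _).trans (max_le ((degreeOf_add_le _ _ _).trans (max_le ?_ ?_)) ?_)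
    · refine (degreeOf_mul_le _ _ _).trans ?_
      rw [hCdeg, zero_add]
      refine (degreeOf_pow_le _ _ _).trans ?_
      rw [degreeOf_X, if_neg (by decide), mul_zero]
    · refine (degreeOf_pow_le _ _ _).trans ?_
      rw [hφdeg, mul_zero]
    · refine (degreeOf_mul_le _ _ _).trans ?_
      rw [degreeOf_X, if_neg (by decide), add_zero]
      refine (degreeOf_mul_le _ _ _).trans ?_
      rw [show degreeOf 2 (X 0 ^ 3 : MvPolynomial (Fin 4) (MvPolynomial (Fin 1) k)) = 0 from
        Nat.eq_zero_of_le_zero ((degreeOf_pow_le _ _ _).trans (by rw [degreeOf_X, if_neg (by decide), mul_zero])), add_zero]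
      refine (degreeOf_mul_le _ _ _).trans ?_
      rw [hCdeg, zero_add, degreeOf_X, if_neg (by decide)]
  rw [FedderViaSlicing.coeff_X_pow_add_pow 2 2 4 2 (by norm_num) (by norm_num) u hu _ (by simp),
    show (4 - 2 : ℕ) = 2 from rfl, show (Nat.choose 4 2 : MvPolynomial (Fin 1) k) = 6 by norm_num [Nat.choose],
    show (36 : MvPolynomial (Fin 1) k) * a ^ 6 = 6 * (6 * a ^ 6) by ring]
  congr 1
  -- the explicit square
  have hsq : u ^ 2 = C (6 * a ^ 6) * (X 3 ^ 4 * X 0 ^ 3 * X 1 ^ 4) +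
      X 3 ^ 5 * (C a ^ 12 * X 3 ^ 3 + 2 * C a ^ 9 * X 0 ^ 3 * X 1) +
      X 1 ^ 5 * (2 * C a ^ 6 * X 1 * X 3 ^ 4 + 6 * C a ^ 3 * X 0 ^ 6 * X 3 + 2 * C a ^ 3 * X 0 ^ 3 * X 1 ^ 2 * X 3 + 20 * X 0 ^ 9 * X 1 +
        15 * X 0 ^ 6 * X 1 ^ 3 + 6 * X 0 ^ 3 * X 1 ^ 5 + X 1 ^ 7) +
      X 0 ^ 4 * (2 * C a ^ 6 * X 0 ^ 5 * X 3 ^ 4 + 6 * C a ^ 6 * X 0 ^ 2 * X 1 ^ 2 * X 3 ^ 4 + C a ^ 6 * X 0 ^ 2 * X 1 ^ 2 * X 3 ^ 2 +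
        2 * C a ^ 3 * X 0 ^ 8 * X 1 * X 3 + 6 * C a ^ 3 * X 0 ^ 5 * X 1 ^ 3 * X 3 + X 0 ^ 14 + 6 * X 0 ^ 11 * X 1 ^ 2 +
        15 * X 0 ^ 8 * X 1 ^ 4) := by
    rw [hu_def, map_mul, map_pow, map_ofNat]; ring
  rw [hsq, coeff_add, coeff_add, coeff_add, HFedderCertificates.coeff_X_pow_mul_eq_zero _ 3 5 (by simp),
    HFedderCertificates.coeff_X_pow_mul_eq_zero _ 1 5 (by simp), HFedderCertificates.coeff_X_pow_mul_eq_zero _ 0 4 (by simp),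
    add_zero, add_zero, add_zero, X_pow_eq_monomial, X_pow_eq_monomial, X_pow_eq_monomial, monomial_mul, monomial_mul, mul_one,
    mul_one, coeff_C_mul, coeff_monomial, if_pos rfl, mul_one]

/-- **Along `S`, `t = 0`: the `z⁴w³t`-coefficient of `g₀⁴` is `12·q·P³`** (`P = φ`, `q = x³y` in the base `k[x,y]`; slices
`Y₀,Y₁,Y₂ = z,w,t`; `G = Y₀² + u`, `u = Y₂⁴Y₁⁶ + C(P)³ + C(q)Y₂Y₁³`). [folklore] -/
theorem coeff_along_S_plane (k : Type) [Field k] (P q : MvPolynomial (Fin 2) k) :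
    coeff (Finsupp.single (0 : Fin 3) (2 * 2) + (Finsupp.single 1 3 + Finsupp.single 2 1))
      ((X 0 ^ 2 + (X 2 ^ 4 * X 1 ^ 6 + C P ^ 3 + C q * X 2 * X 1 ^ 3) : MvPolynomial (Fin 3) (MvPolynomial (Fin 2) k)) ^ 4) =
        12 * q * P ^ 3 := by
  set u : MvPolynomial (Fin 3) (MvPolynomial (Fin 2) k) := X 2 ^ 4 * X 1 ^ 6 + C P ^ 3 + C q * X 2 * X 1 ^ 3 with hu_def
  have hCdeg : ∀ (b : MvPolynomial (Fin 2) k) (n : ℕ), degreeOf 0 (C b ^ n : MvPolynomial (Fin 3) (MvPolynomial (Fin 2) k)) = 0 :=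
    fun b n => by
    apply Nat.eq_zero_of_le_zero
    refine (degreeOf_pow_le _ _ _).trans ?_
    rw [degreeOf_C, mul_zero]
  have hu : degreeOf 0 u = 0 := by
    apply Nat.eq_zero_of_le_zero
    refine (degreeOf_add_le _ _ _).trans (max_le ((degreeOf_add_le _ _ _).trans (max_le ?_ ?_)) ?_)
    · refine (degreeOf_mul_le _ _ _).trans (add_le_of_le_of_nonpos ?_ ?_) <;>
      · refine (degreeOf_pow_le _ _ _).trans ?_
        rw [degreeOf_X, if_neg (by decide), mul_zero]
    · rw [hCdeg]
    · refine (degreeOf_mul_le _ _ _).trans ?_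
      rw [show degreeOf 0 (X 1 ^ 3 : MvPolynomial (Fin 3) (MvPolynomial (Fin 2) k)) = 0 from
        Nat.eq_zero_of_le_zero ((degreeOf_pow_le _ _ _).trans (by rw [degreeOf_X, if_neg (by decide), mul_zero])), add_zero]
      refine (degreeOf_mul_le _ _ _).trans ?_
      rw [← pow_one (C q), hCdeg, zero_add, degreeOf_X, if_neg (by decide)]
  rw [FedderViaSlicing.coeff_X_pow_add_pow 0 2 4 2 (by norm_num) (by norm_num) u hu _ (by simp),
    show (4 - 2 : ℕ) = 2 from rfl, show (Nat.choose 4 2 : MvPolynomial (Fin 2) k) = 6 by norm_num [Nat.choose],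
    show (12 : MvPolynomial (Fin 2) k) * q * P ^ 3 = 6 * (2 * q * P ^ 3) by ring]
  congr 1
  have hsq : u ^ 2 = C (2 * q * P ^ 3) * (X 1 ^ 3 * X 2 ^ 1) +
      X 2 ^ 2 * (2 * C P ^ 3 * X 1 ^ 6 * X 2 ^ 2 + C q ^ 2 * X 1 ^ 6 + 2 * C q * X 1 ^ 9 * X 2 ^ 3 + X 1 ^ 12 * X 2 ^ 6) +
      C (P ^ 6) := by
    rw [hu_def, map_mul, map_mul, map_pow, map_pow, map_ofNat]; ring
  rw [hsq, coeff_add, coeff_add, HFedderCertificates.coeff_X_pow_mul_eq_zero _ 2 2 (by simp), add_zero, coeff_C, if_neg,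
    add_zero, X_pow_eq_monomial, X_pow_eq_monomial, monomial_mul, mul_one, coeff_C_mul, coeff_monomial, if_pos rfl, mul_one]
  rw [eq_comm, Finsupp.ext_iff, not_forall]
  exact ⟨1, by simp⟩

/-- **Along `S`, `t ≠ 0`: the `z⁴w³`-coefficient of `g₀⁴` is `12·q·P³`** (`P = φ`, `q = t·x³y`, `c = t⁴` in the base `k[x,y,t]`;
slices `Y₀,Y₁ = z,w`; `G = Y₀² + u`, `u = C(c)Y₁⁶ + C(P)³ + C(q)Y₁³`). [folklore] -/
theorem coeff_along_S_xyt (k : Type) [Field k] (P q c : MvPolynomial (Fin 3) k) :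
    coeff (Finsupp.single (0 : Fin 2) (2 * 2) + Finsupp.single 1 3)
      ((X 0 ^ 2 + (C c * X 1 ^ 6 + C P ^ 3 + C q * X 1 ^ 3) : MvPolynomial (Fin 2) (MvPolynomial (Fin 3) k)) ^ 4) =
        12 * q * P ^ 3 := by
  set u : MvPolynomial (Fin 2) (MvPolynomial (Fin 3) k) := C c * X 1 ^ 6 + C P ^ 3 + C q * X 1 ^ 3 with hu_def
  have hCdeg : ∀ (b : MvPolynomial (Fin 3) k) (n : ℕ), degreeOf 0 (C b ^ n : MvPolynomial (Fin 2) (MvPolynomial (Fin 3) k)) = 0 :=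
    fun b n => by
    apply Nat.eq_zero_of_le_zero
    refine (degreeOf_pow_le _ _ _).trans ?_
    rw [degreeOf_C, mul_zero]
  have hu : degreeOf 0 u = 0 := by
    apply Nat.eq_zero_of_le_zero
    refine (degreeOf_add_le _ _ _).trans (max_le ((degreeOf_add_le _ _ _).trans (max_le ?_ ?_)) ?_)
    · refine (degreeOf_mul_le _ _ _).trans ?_
      rw [degreeOf_C, zero_add]
      refine (degreeOf_pow_le _ _ _).trans ?_
      rw [degreeOf_X, if_neg (by decide), mul_zero]
    · rw [hCdeg]
    · refine (degreeOf_mul_le _ _ _).trans ?_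
      rw [degreeOf_C, zero_add]
      refine (degreeOf_pow_le _ _ _).trans ?_
      rw [degreeOf_X, if_neg (by decide), mul_zero]
  rw [FedderViaSlicing.coeff_X_pow_add_pow 0 2 4 2 (by norm_num) (by norm_num) u hu _ (by simp),
    show (4 - 2 : ℕ) = 2 from rfl, show (Nat.choose 4 2 : MvPolynomial (Fin 3) k) = 6 by norm_num [Nat.choose],
    show (12 : MvPolynomial (Fin 3) k) * q * P ^ 3 = 6 * (2 * q * P ^ 3) by ring]
  congr 1
  have hsq : u ^ 2 = C (2 * q * P ^ 3) * X 1 ^ 3 +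
      X 1 ^ 4 * (C c ^ 2 * X 1 ^ 8 + 2 * C c * C P ^ 3 * X 1 ^ 2 + 2 * C c * C q * X 1 ^ 5 + C q ^ 2 * X 1 ^ 2) + C (P ^ 6) := by
    rw [hu_def, map_mul, map_mul, map_pow, map_pow, map_ofNat]; ring
  rw [hsq, coeff_add, coeff_add, HFedderCertificates.coeff_X_pow_mul_eq_zero _ 1 4 (by simp), add_zero, coeff_C, if_neg,
    add_zero, X_pow_eq_monomial, coeff_C_mul, coeff_monomial, if_pos rfl, mul_one]
  rw [eq_comm, Finsupp.single_eq_zero]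
  norm_num

end Summit.ResolutionOfSingularities.ResolutionOfSingularities.Theorems.FInjectiveMacaulayfication.RelGddF008ConeData

end
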